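import Summits.BirchSwinnertonDyer.Rank1Residual.Additive.LocalSubgroupTransport
import Literature.NumberTheory.EllipticCurves.ZpExtensionRestrict
import Mathlib.GroupTheory.IndexNormal
import HarnessLib

/-!
# Route `SignedLowerHalves`, crux L `SmallImageLowerHalfBothSigns` (stmt-BirchSwinnertonDyer-23599), line `rtt_w3` v11 — brick D3-W, CONCRETE HALF,
# part 1 (memo `Lines/rtt_w3-MEMO-D3c-w3g17.md` §2/§5, HELPER-TABLE v11 row D3-W-a): the LOCAL BASE-CHANGE SQUARE at an inert place —
# the index-`2` subgroup `Λ' = localSubgroupOfEmb (H ⊓ galRange K) ι` of the local group `Λ = localSubgroupOfEmb H ι` (the elements restricting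
# into the quadratic field `K`), its index-`2` structure under an element `c` restricting OUTSIDE `galRange K`, the FIXING hypothesis `hfix` of the
# tree's transport `LocalTransport.transportHom` for it (every `h ∈ Λ'` fixes the copy `ι₂⁻¹(E')` of the quadratic completion `E' = E + E·θ₀`), and
# the first consequence for the descent: transported `E'`-side points fixed by the `K`-side local group are fixed by `Λ'`.

Width seat `bsd-line-slh-p3-w3` g17 under LEAD `cruxlead-stmt-BirchSwinnertonDyer-23599` (cell `bsd-ssimc`; `--supports stmt-BirchSwinnertonDyer-23599 --as helper`).
THEOREMS ONLY (no definition, no named fact, no instance, no `sorry`). It instantiates NOTHING at the actual completions: `k ⊆ K` any algebraic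
extension of fields (`ℚ ⊆ K` quadratic), `E` a `k`-field (`ℚ_p`), `E'` a `K`-field and `E`-algebra (`K_v ⊇ ℚ_p`), `ι : k̄ → Ē`, `ι₂ : Ē ≃ Ē'`,
`ι' : K̄ → Ē'` with `ι' ∘ ι_{K/k} = ι₂ ∘ ι` — EXACTLY the data of `Rank1Residual/Additive/LocalSubgroupTransport` (cell b2b) — plus the two algebraic
facts `E' = E + E·θ₀` (`hgen`, `θ₀ ∈ K`; at an inert `p`: `K_v = ℚ_p ⊕ ℚ_p√d`) and `ι₂⁻¹` being `E`-linear (`hι₂`). Supplying these data for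
`(ℚ, K, ℚ_p, K_v)` and the element `c` (a Frobenius of the inert `p`) is the residual part D3-W-a′ (memo §5). BSD / crux L are NOT proved here.

WHAT:
* §1 `layerSubgroup_restrictOfFinrankEqTwo` — the `K`-side layers are the preimages of the `ℚ`-side layers (`Γ_{K_n} = res⁻¹ Γ_{ℚ_n}`).
* §2 index-`2` structure: `localSubgroupOfEmb_inf_le`, `mul_self_mem_localSubgroupOfEmb_inf`, `conj_mem_localSubgroupOfEmb_inf`,
  `mem_or_inv_mul_mem_localSubgroupOfEmb_inf` — the hypotheses `hΛ' hcc hnorm hcov` of ★★ `mem_localKummerOverOfEmb_of_kummer_on_index_two`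
  (p765485) for `Λ' = localSubgroupOfEmb (H ⊓ U) ι`, `U` of index `2` (`= galRange K`), `c ∈ Λ` with `ι`-restriction outside `U`.
* §3 ★ `smul_symm_algebraMap_eq_of_mem_galRange` — `hfix`: an `h ∈ Γ_E` whose `ι`-restriction lies in `galRange K` fixes `ι₂⁻¹(E')` pointwise
  (it fixes `ι₂⁻¹(θ₀) = ι(z₀)`, `z₀` the preimage of `θ₀` in `k̄`, because `galRange K` fixes `z₀`; and `E' = E + Eθ₀`); `hfix_inf` — the form
  consumed by `LocalTransport.transportHom` with `H ⊓ galRange K`.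
* §4 ★ `smul_transportPoints_eq_of_forall_smul_eq` — `hA'fix`: a point of `E_K(Ē')` fixed by the `K`-side local group `localSubgroupOfEmb H' ι'`
  has `Λ'`-fixed transport in `E(Ē)` (`transportPoints_smul`).

References: [SerreGaloisCohomology1997] II §1.1 (local embeddings, decomposition groups), I §2.6 (b); [NeukirchANT1999] II §8–§9 (completions of a
quadratic field at an inert prime); [MilneADT2006] I Prop. 3.8 (the classical shadow of D3-W).
-/

set_option autoImplicit false
set_option linter.dupNamespace false -- D-0017: single-problem summit, the namespace repeats the problem name by design
noncomputable section

open scoped Classical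

universe u

namespace Summit.BirchSwinnertonDyer.BirchSwinnertonDyer.Theorems.SmallImageCharSignedSelmer

open Literature.NumberTheory.EllipticCurves Literature.NumberTheory.GaloisRepresentations Field
  Summit.BirchSwinnertonDyer.Rank1Residual.Additive.LocalTransport

/-! ## §1. The `K`-side layers are the preimages of the `ℚ`-side layers -/

section Layers

variable {k : Type u} [Field k] [NumberField k] {p : ℕ} [Fact p.Prime]

/-- **`Gal(K̄/K_n) = res⁻¹ Gal(k̄/k_n)`** for the restricted `ℤ_p`-extension along a quadratic `K/k` (`p ≠ 2`): the layer subgroups of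
`κ.restrictOfFinrankEqTwo` are the preimages of those of `κ` under `absGaloisRestrict k K` (companion of the tree's `kerSubgroup_restrict`).
[cite: Washington1997, §13.1] -/
theorem layerSubgroup_restrictOfFinrankEqTwo (hp : p ≠ 2) (κ : ZpExtension k p) (K : Type u) [Field K] [NumberField K] [Algebra k K]
    (hK : Module.finrank k K = 2) (n : ℕ) :
    (κ.restrictOfFinrankEqTwo hp K hK).layerSubgroup n = (κ.layerSubgroup n).comap (absGaloisRestrict k K).toMonoidHom := by
  ext σ
  rw [ZpExtension.mem_layerSubgroup, Subgroup.mem_comap, ZpExtension.mem_layerSubgroup, ZpExtension.restrictOfFinrankEqTwo_apply]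
  rfl

end Layers

/-! ## §2. The index-`2` subgroup `Λ' = localSubgroupOfEmb (H ⊓ U) ι` of the local group -/

section IndexTwo

variable {k : Type u} [Field k] (H U : Subgroup (absoluteGaloisGroup k)) {E : Type u} [Field E] [Algebra k E]
  (ι : AlgebraicClosure k →ₐ[k] AlgebraicClosure E)

/-- `Λ' = localSubgroupOfEmb (H ⊓ U) ι ≤ Λ = localSubgroupOfEmb H ι`. [cite: SerreGaloisCohomology1997, II §1.1] -/
theorem localSubgroupOfEmb_inf_le : localSubgroupOfEmb (H ⊓ U) ι ≤ localSubgroupOfEmb H ι :=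
  Subgroup.comap_mono inf_le_left

variable {H U ι}

/-- Membership in `Λ'`: restriction into `H` and into `U`. [cite: SerreGaloisCohomology1997, II §1.1] -/
theorem mem_localSubgroupOfEmb_inf_iff (x : absoluteGaloisGroup E) :
    x ∈ localSubgroupOfEmb (H ⊓ U) ι ↔ resGalOfEmb ι x ∈ H ∧ resGalOfEmb ι x ∈ U := by
  rw [mem_localSubgroupOfEmb_iff, Subgroup.mem_inf]

/-- `c² ∈ Λ'` for `c ∈ Λ` when `U` has index `2`. [cite: SerreGaloisCohomology1997, I §2.6 (b)] -/
theorem mul_self_mem_localSubgroupOfEmb_inf (hU : U.index = 2) {c : absoluteGaloisGroup E} (hc : c ∈ localSubgroupOfEmb H ι) :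
    c * c ∈ localSubgroupOfEmb (H ⊓ U) ι := by
  rw [mem_localSubgroupOfEmb_inf_iff, map_mul]
  exact ⟨H.mul_mem hc hc, Subgroup.mul_self_mem_of_index_two hU _⟩

/-- `Λ'` is normalised by `c ∈ Λ` (`H` normal, `U` of index `2` hence normal). [cite: SerreGaloisCohomology1997, I §2.6 (b)] -/
theorem conj_mem_localSubgroupOfEmb_inf [H.Normal] (hU : U.index = 2) {c : absoluteGaloisGroup E} (hc : c ∈ localSubgroupOfEmb H ι)
    (x : absoluteGaloisGroup E) (hx : x ∈ localSubgroupOfEmb (H ⊓ U) ι) : c⁻¹ * x * c ∈ localSubgroupOfEmb (H ⊓ U) ι := by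
  haveI : U.Normal := Subgroup.normal_of_index_eq_two hU
  rw [mem_localSubgroupOfEmb_inf_iff] at hx ⊢
  rw [map_mul, map_mul, map_inv]
  have hc' : resGalOfEmb ι c ∈ H := hc
  refine ⟨?_, ?_⟩
  · simpa only [inv_inv] using ‹H.Normal›.conj_mem _ hx.1 (resGalOfEmb ι c)⁻¹
  · simpa only [inv_inv] using ‹U.Normal›.conj_mem _ hx.2 (resGalOfEmb ι c)⁻¹

/-- `Λ = Λ' ∪ cΛ'` for `c ∈ Λ` restricting OUTSIDE `U` (index `2`: of `b` and `c⁻¹b` exactly one restricts into `U`).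
[cite: SerreGaloisCohomology1997, I §2.6 (b)] -/
theorem mem_or_inv_mul_mem_localSubgroupOfEmb_inf (hU : U.index = 2) {c : absoluteGaloisGroup E} (hc : c ∈ localSubgroupOfEmb H ι)
    (hcU : resGalOfEmb ι c ∉ U) (b : absoluteGaloisGroup E) (hb : b ∈ localSubgroupOfEmb H ι) :
    b ∈ localSubgroupOfEmb (H ⊓ U) ι ∨ c⁻¹ * b ∈ localSubgroupOfEmb (H ⊓ U) ι := by
  by_cases hbU : resGalOfEmb ι b ∈ U
  · exact Or.inl ((mem_localSubgroupOfEmb_inf_iff b).2 ⟨hb, hbU⟩)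
  · have hc' : resGalOfEmb ι c ∈ H := hc
    have hb' : resGalOfEmb ι b ∈ H := hb
    have h1 : resGalOfEmb ι (c⁻¹ * b) ∈ H := by
      rw [map_mul, map_inv]; exact H.mul_mem (H.inv_mem hc') hb'
    have h2 : resGalOfEmb ι (c⁻¹ * b) ∈ U := by
      rw [map_mul, map_inv, Subgroup.mul_mem_iff_of_index_two hU, Subgroup.inv_mem_iff]
      exact ⟨fun h ↦ absurd h hcU, fun h ↦ absurd h hbU⟩
    exact Or.inr ((mem_localSubgroupOfEmb_inf_iff _).2 ⟨h1, h2⟩)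

end IndexTwo

/-! ## §3. The fixing hypothesis `hfix` of the transport for `Λ'`: `Λ'` fixes `ι₂⁻¹(E')` -/

section Fix

variable {k : Type u} [Field k] (K : Type u) [Field K] [Algebra k K] [Algebra.IsAlgebraic k K]
  {E : Type u} [Field E] [Algebra k E] {E' : Type u} [Field E'] [Algebra K E'] [Algebra E E']
  (ι : AlgebraicClosure k →ₐ[k] AlgebraicClosure E) (ι₂ : AlgebraicClosure E ≃+* AlgebraicClosure E')
  (ι' : AlgebraicClosure K →ₐ[K] AlgebraicClosure E')
  (hcompat : ∀ z : AlgebraicClosure k, ι' (closureEmb (K := k) K z) = ι₂ (ι z))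
  (hι₂ : ∀ a : E, ι₂.symm (algebraMap E' (AlgebraicClosure E') (algebraMap E E' a)) = algebraMap E (AlgebraicClosure E) a)
  (θ₀ : K) (hgen : ∀ y : E', ∃ a b : E, y = algebraMap E E' a + algebraMap E E' b * algebraMap K E' θ₀)

/-- Elements of `galRange K ≤ Γ_k` fix the preimage in `k̄` of every element of `K ⊆ K̄` (they are restrictions of `K`-automorphisms).
[cite: SerreGaloisCohomology1997, II §1.1] -/
theorem smul_eq_of_mem_galRange {g : absoluteGaloisGroup k} (hg : g ∈ galRange (K := k) K) (z : AlgebraicClosure k) (x : K)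
    (hz : closureEmb (K := k) K z = algebraMap K (AlgebraicClosure K) x) :
    (show AlgebraicClosure k ≃ₐ[k] AlgebraicClosure k from g) z = z := by
  obtain ⟨τ, rfl⟩ := (mem_galRange_iff K g).1 hg
  apply (algEquivOfEmb K (closureEmb (K := k) K)).injective
  rw [algEquivOfEmb_resGal_apply, algEquivOfEmb_apply, hz, AlgEquiv.commutes]

include hcompat hι₂ hgen in
/-- ★ **`hfix` for `Λ'`: an `h ∈ Γ_E` whose `ι`-restriction lies in `galRange K` fixes `ι₂⁻¹(E')` pointwise.** Write `y = a + bθ₀`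
(`hgen`); `ι₂⁻¹` is `E`-linear (`hι₂`) and `h` is `E`-linear, so it suffices that `h` fixes `ι₂⁻¹(θ₀) = ι(z₀)` for the preimage `z₀ ∈ k̄` of
`θ₀ ∈ K ⊆ K̄` (`hcompat`), i.e. that `res_ι h` fixes `z₀` (`ι ∘ res_ι h = h ∘ ι`) — which it does, lying in `galRange K`.
In D3-W: `E = ℚ_p`, `E' = K_v = ℚ_p + ℚ_p√d` at the inert `p`. [cite: SerreGaloisCohomology1997, II §1.1] [cite: NeukirchANT1999, II §8] -/
theorem smul_symm_algebraMap_eq_of_mem_galRange {h : absoluteGaloisGroup E} (hh : resGalOfEmb ι h ∈ galRange (K := k) K) (y : E') :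
    (show AlgebraicClosure E ≃ₐ[E] AlgebraicClosure E from h) (ι₂.symm (algebraMap E' (AlgebraicClosure E') y)) =
      ι₂.symm (algebraMap E' (AlgebraicClosure E') y) := by
  -- the preimage `z₀ ∈ k̄` of `θ₀`
  set e : AlgebraicClosure k ≃ₐ[k] AlgebraicClosure K := algEquivOfEmb K (closureEmb (K := k) K) with he
  set z₀ : AlgebraicClosure k := e.symm (algebraMap K (AlgebraicClosure K) θ₀) with hz₀
  have hz₀' : closureEmb (K := k) K z₀ = algebraMap K (AlgebraicClosure K) θ₀ := by
    rw [← algEquivOfEmb_apply K (closureEmb (K := k) K), hz₀, AlgEquiv.apply_symm_apply]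
  -- `ι z₀ = ι₂⁻¹(θ₀)`
  have hιz₀ : ι z₀ = ι₂.symm (algebraMap E' (AlgebraicClosure E') (algebraMap K E' θ₀)) := by
    rw [← IsScalarTower.algebraMap_apply K E' (AlgebraicClosure E'), ← ι'.commutes θ₀, ← hz₀', hcompat, RingEquiv.symm_apply_apply]
  -- `h` fixes `ι z₀`
  have hfixz : (show AlgebraicClosure E ≃ₐ[E] AlgebraicClosure E from h) (ι z₀) = ι z₀ := by
    rw [← apply_resGalAuxOfEmb_apply ι h z₀]
    exact congrArg ι (smul_eq_of_mem_galRange K hh z₀ θ₀ hz₀')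
  obtain ⟨a, b, rfl⟩ := hgen y
  rw [map_add, map_mul, map_add, map_mul, hι₂, hι₂, ← hιz₀, map_add, map_mul, AlgEquiv.commutes, AlgEquiv.commutes, hfixz]

include hcompat hι₂ hgen in
/-- **`hfix` in the form consumed by `LocalTransport.transportHom` with `H ⊓ galRange K`** (every `h` restricting into `H ⊓ galRange K` fixes
`ι₂⁻¹(E')`). [cite: SerreGaloisCohomology1997, II §1.1] -/
theorem hfix_inf (H : Subgroup (absoluteGaloisGroup k)) :
    ∀ h : absoluteGaloisGroup E, resGalOfEmb ι h ∈ H ⊓ galRange (K := k) K → ∀ y : E',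
      (show AlgebraicClosure E ≃ₐ[E] AlgebraicClosure E from h) (ι₂.symm (algebraMap E' (AlgebraicClosure E') y)) =
        ι₂.symm (algebraMap E' (AlgebraicClosure E') y) :=
  fun _ hh y ↦ smul_symm_algebraMap_eq_of_mem_galRange K ι ι₂ ι' hcompat hι₂ θ₀ hgen (Subgroup.mem_inf.1 hh).2 y

end Fix

/-! ## §4. `hA'fix`: transported `K`-side-fixed points are `Λ'`-fixed -/

section Points

variable {k : Type u} [Field k] (K : Type u) [Field K] [Algebra k K] [Algebra.IsAlgebraic k K]
  (H : Subgroup (absoluteGaloisGroup k)) (H' : Subgroup (absoluteGaloisGroup K))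
  (hHH' : ∀ τ : absoluteGaloisGroup K, resGal (K := k) K τ ∈ H → τ ∈ H')
  {E : Type u} [Field E] [Algebra k E] {E' : Type u} [Field E'] [Algebra K E'] [Algebra k E'] [IsScalarTower k K E']
  (ι : AlgebraicClosure k →ₐ[k] AlgebraicClosure E) (ι₂ : AlgebraicClosure E ≃+* AlgebraicClosure E')
  (ι' : AlgebraicClosure K →ₐ[K] AlgebraicClosure E')
  (hcompat : ∀ z : AlgebraicClosure k, ι' (closureEmb (K := k) K z) = ι₂ (ι z))
  (hfix : ∀ h : absoluteGaloisGroup E, resGalOfEmb ι h ∈ H → ∀ y : E',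
    (show AlgebraicClosure E ≃ₐ[E] AlgebraicClosure E from h) (ι₂.symm (algebraMap E' (AlgebraicClosure E') y)) =
      ι₂.symm (algebraMap E' (AlgebraicClosure E') y))
  (W : WeierstrassCurve k)

include hHH' hfix in
/-- ★ **`hA'fix`.** If `P' ∈ E_K(Ē')` is fixed by the `K`-side local group `localSubgroupOfEmb H' ι'` (a point of `E^ε(K_n·K_v)`), then its transport
`transportPoints P' ∈ E(Ē)` is fixed by every `x` of the `k`-side group `localSubgroupOfEmb H ι` on which the transport is defined
(`transportPoints (θ x • P') = x • transportPoints P'`, `θ x ∈ localSubgroupOfEmb H' ι'`). With `H := Γ_{ℚ_n} ⊓ galRange K` this is the hypothesis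
`hA'fix` of p765485 for `A' = transportPoints (E^ε(K_n·K_v))`. [cite: SerreGaloisCohomology1997, I §2.4, II §1.1] -/
theorem smul_transportPoints_eq_of_forall_smul_eq {P' : localPoints (W.baseChange K) E'}
    (hP' : ∀ y : localSubgroupOfEmb H' ι', (y : absoluteGaloisGroup E') • P' = P')
    (x : absoluteGaloisGroup E) (hx : x ∈ localSubgroupOfEmb H ι) :
    x • transportPoints K ι ι₂ ι' hcompat W P' = transportPoints K ι ι₂ ι' hcompat W P' := by
  have h := transportPoints_smul K H H' hHH' ι ι₂ ι' hcompat hfix W ⟨x, hx⟩ P'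
  change ((⟨x, hx⟩ : localSubgroupOfEmb H ι) : absoluteGaloisGroup E) • _ = _
  rw [← Subgroup.smul_def, ← h, Subgroup.smul_def, hP']

end Points

end Summit.BirchSwinnertonDyer.BirchSwinnertonDyer.Theorems.SmallImageCharSignedSelmer

end
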